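import Literature.MathematicalPhysics.QuantumLattice.HubbardTwoPointMatsubaraLimit
import Literature.MathematicalPhysics.QuantumLattice.HubbardFermiLiquid
import Literature.MathematicalPhysics.QuantumLattice.HubbardGaugeBound
import HarnessLib

/-!
# The normalised Grassmann two-point function converges to the Hubbard thermal two-point function minus `½δ`

Topic `MathematicalPhysics/QuantumLattice`; the dictionary corollary of the `M → ∞` ("Matsubara UV") bridge
(`HubbardPartitionFunctionMatsubaraLimit`: partition function; `HubbardTwoPointMatsubaraLimit`: two-point numerator)
in the vocabulary of the tree's fact `bgm_two_point_limit` (`HubbardFermiLiquid.hubbardThermalTwoPoint`, the finite-volume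
equal-time thermal two-point function `Tr(e^{-βH} c†_{xσ} c_{yσ'})/Tr e^{-βH}` of the Hubbard torus).  For `L ≥ 3`,
`β > 0` and `3e · |U| · L²β · B² < 1` (`B = L⁻² Σ_{k⃗}(2 + β|ξ_{k⃗}|/3)`):

* `tendsto_gaussExpect_twoPoint_div_effPartitionFn` — the RATIO of the Grassmann two-point numerator and the
  Grassmann partition function converges to `Tr(e^{-βH'}c†_{x⃗ₑσ}c_{y⃗ₑσ'})/Tr e^{-βH'} − ½[σ=σ'][x⃗ₑ=y⃗ₑ]`,
  `H' = hubbardTorusWith 2 L 1 U (μ + U/2)` (the constants `e^{-βUL²/4}/Z₀` cancel);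
* **`tendsto_grassmannTwoPoint_eq_hubbardThermalTwoPoint_sub`** — for lattice sites `x, y ∈ ℤ²`:
  `∫dμ_{C_M}ψ⁺_{(x̄,0)σ}ψ⁻_{(ȳ,0)σ'}e^{−V} / ∫dμ_{C_M}e^{−V} ⟶ hubbardThermalTwoPoint β U (μ + U/2) L x y σ σ' − ½[σ=σ'][x̄=ȳ]`
  (`x̄ = Torus.proj L x`): the engine's Grassmann representation at covariance chemical potential `μ` (interaction
  `U∫ψ⁺↑ψ⁻↑ψ⁺↓ψ⁻↓`, symmetric frequency truncation) computes the Hubbard model at chemical potential `μ + U/2`, and its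
  equal-time two-point function carries the midpoint correction `−½δ`.

## Sources

G. Benfatto, A. Giuliani, V. Mastropietro, Ann. Henri Poincaré 7 (2006) 809–898 = arXiv:cond-mat/0507686, §1.2
(1.2)–(1.4), §2.1 (2.6)–(2.8) [`BenfattoGiulianiMastropietro2006`].
-/

noncomputable section

namespace Literature.MathematicalPhysics.QuantumLattice

open GrassmannAlgebra Finset Filter Literature.Probability.LatticeModels _root_.Topology
open scoped ComplexOrder

variable {L : ℕ} [NeZero L]

/-- **The normalised Grassmann two-point function converges to the Hamiltonian one minus `½δ`**: for `L ≥ 3`, `β > 0`,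
`3e|U|L²βB² < 1`,
`∫dμ_{C_M}ψ⁺_{(x⃗ₑ,0)σ}ψ⁻_{(y⃗ₑ,0)σ'}e^{−V} / ∫dμ_{C_M}e^{−V} ⟶ Tr(e^{−βH'}c†_{x⃗ₑσ}c_{y⃗ₑσ'})/Tr e^{−βH'} − ½[σ=σ'][x⃗ₑ=y⃗ₑ]`,
`H' = hubbardTorusWith 2 L 1 U (μ + U/2)`. [cite: BenfattoGiulianiMastropietro2006, §2.1 (2.8)] -/
theorem tendsto_gaussExpect_twoPoint_div_effPartitionFn (hL : 3 ≤ L) {β : ℝ} (hβ : 0 < β) (μ : ℝ) {U : ℝ}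
    (σ σ' : Fin 2) (xe ye : TorusSite 2 L)
    (hU : 3 * Real.exp 1 * (|U| * (L : ℝ) ^ 2 * β) *
      ((1 / (L : ℝ) ^ 2) * ∑ q : TorusSite 2 L, (2 + β * |nambuXi L μ q| / 3)) ^ 2 < 1) :
    Tendsto (fun M : ℕ => gaussExpect ℂ (hubbardCovariance L M β μ 0)
        (positionField L M β 0 σ xe 0 * positionField L M β 1 σ' ye 0 * grassmannExp (-(hubbardInteraction L M β U))) /
        effPartitionFn ℂ (hubbardCovariance L M β μ 0) (hubbardInteraction L M β U)) atTop
      (𝓝 ((Matrix.gibbsWeight β (hubbardTorusWith 2 L 1 U (μ + U / 2)) *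
            (creation (orb (FermionTorus.ofTorusSite xe) σ) * annihilation (orb (FermionTorus.ofTorusSite ye) σ'))).trace /
          Matrix.partitionFn β (hubbardTorusWith 2 L 1 U (μ + U / 2)) -
        (if σ = σ' ∧ xe = ye then (1 / 2 : ℂ) else 0))) := by
  haveI : Nonempty (Finset (Orb (FermionTorus 2 L))) := ⟨∅⟩
  -- the smallness of the partition-function bridge follows from the (stronger) two-point one
  have hnn : 0 ≤ (|U| * (L : ℝ) ^ 2 * β) *
      ((1 / (L : ℝ) ^ 2) * ∑ q : TorusSite 2 L, (2 + β * |nambuXi L μ q| / 3)) ^ 2 := by positivity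
  have hU2 : 2 * Real.exp 1 * (|U| * (L : ℝ) ^ 2 * β) *
      ((1 / (L : ℝ) ^ 2) * ∑ q : TorusSite 2 L, (2 + β * |nambuXi L μ q| / 3)) ^ 2 < 1 := by
    have he : 0 ≤ Real.exp 1 := (Real.exp_pos 1).le
    nlinarith
  have hZ' : Matrix.partitionFn β (hubbardTorusWith 2 L 1 U (μ + U / 2)) ≠ 0 :=
    (Matrix.partitionFn_pos β (isHermitian_hamiltonianWith (fermionTorusGraph 2 L) 1 U (μ + U / 2))).ne'
  have hZ₀ : Matrix.partitionFn β (hubbardTorusWith 2 L 1 0 μ) ≠ 0 :=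
    (Matrix.partitionFn_pos β (isHermitian_hamiltonianWith (fermionTorusGraph 2 L) 1 0 μ)).ne'
  have he : ((Real.exp (-(β * U / 4 * (L : ℝ) ^ 2)) : ℝ) : ℂ) ≠ 0 := by exact_mod_cast (Real.exp_pos _).ne'
  have hden : ((Real.exp (-(β * U / 4 * (L : ℝ) ^ 2)) : ℝ) : ℂ) * Matrix.partitionFn β (hubbardTorusWith 2 L 1 U (μ + U / 2)) /
      Matrix.partitionFn β (hubbardTorusWith 2 L 1 0 μ) ≠ 0 :=
    div_ne_zero (mul_ne_zero he hZ') hZ₀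
  have key := (tendsto_gaussExpect_twoPoint_eq_trace_div hL hβ μ σ σ' xe ye hU).div
    (tendsto_effPartitionFn_hubbard_eq_partitionFn_div hL hβ μ hU2) hden
  set T : ℂ := (Matrix.gibbsWeight β (hubbardTorusWith 2 L 1 U (μ + U / 2)) *
    (creation (orb (FermionTorus.ofTorusSite xe) σ) * annihilation (orb (FermionTorus.ofTorusSite ye) σ'))).trace with hT
  set Z' : ℂ := Matrix.partitionFn β (hubbardTorusWith 2 L 1 U (μ + U / 2)) with hZ'def
  set Z₀ : ℂ := Matrix.partitionFn β (hubbardTorusWith 2 L 1 0 μ) with hZ₀def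
  set e : ℂ := ((Real.exp (-(β * U / 4 * (L : ℝ) ^ 2)) : ℝ) : ℂ) with hedef
  set corr : ℂ := (if σ = σ' ∧ xe = ye then (1 / 2 : ℂ) else 0) with hcorr
  have hlim : e * (T - corr * Z') / Z₀ / (e * Z' / Z₀) = T / Z' - corr := by
    field_simp
  rw [← hlim]
  exact key

/-- **The engine's Grassmann two-point function and the Hubbard thermal two-point function of `bgm_two_point_limit`.**
For `L ≥ 3`, `β > 0`, `3e|U|L²βB² < 1` and lattice sites `x, y ∈ ℤ²` (projected to the torus, `x̄ = Torus.proj L x`):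
`∫dμ_{C_M}ψ⁺_{(x̄,0)σ}ψ⁻_{(ȳ,0)σ'}e^{−V_M(U)} / ∫dμ_{C_M}e^{−V_M(U)} ⟶ hubbardThermalTwoPoint β U (μ + U/2) L x y σ σ' − ½[σ=σ'][x̄=ȳ]`
as `M → ∞` — the Grassmann representation at covariance chemical potential `μ` describes the Hubbard torus at `μ + U/2`,
with the midpoint correction at coinciding orbitals. [cite: BenfattoGiulianiMastropietro2006, §2.1 (2.8)] -/
theorem tendsto_grassmannTwoPoint_eq_hubbardThermalTwoPoint_sub (hL : 3 ≤ L) {β : ℝ} (hβ : 0 < β) (μ : ℝ) {U : ℝ}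
    (σ σ' : Fin 2) (x y : Site 2)
    (hU : 3 * Real.exp 1 * (|U| * (L : ℝ) ^ 2 * β) *
      ((1 / (L : ℝ) ^ 2) * ∑ q : TorusSite 2 L, (2 + β * |nambuXi L μ q| / 3)) ^ 2 < 1) :
    Tendsto (fun M : ℕ => gaussExpect ℂ (hubbardCovariance L M β μ 0)
        (positionField L M β 0 σ (Torus.proj L x) 0 * positionField L M β 1 σ' (Torus.proj L y) 0 *
          grassmannExp (-(hubbardInteraction L M β U))) /
        effPartitionFn ℂ (hubbardCovariance L M β μ 0) (hubbardInteraction L M β U)) atTop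
      (𝓝 (hubbardThermalTwoPoint β U (μ + U / 2) L x y σ σ' -
        (if σ = σ' ∧ Torus.proj L x = Torus.proj L y then (1 / 2 : ℂ) else 0))) := by
  have hval : hubbardThermalTwoPoint β U (μ + U / 2) L x y σ σ' =
      (Matrix.gibbsWeight β (hubbardTorusWith 2 L 1 U (μ + U / 2)) *
          (creation (orb (FermionTorus.ofTorusSite (Torus.proj L x)) σ) *
            annihilation (orb (FermionTorus.ofTorusSite (Torus.proj L y)) σ'))).trace /
        Matrix.partitionFn β (hubbardTorusWith 2 L 1 U (μ + U / 2)) := by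
    rw [hubbardThermalTwoPoint, dif_neg (NeZero.ne L), Matrix.thermalCorr, Matrix.gibbsState_apply]
    exact (div_eq_inv_mul _ _).symm
  rw [hval]
  exact tendsto_gaussExpect_twoPoint_div_effPartitionFn hL hβ μ σ σ' (Torus.proj L x) (Torus.proj L y) hU

end Literature.MathematicalPhysics.QuantumLattice
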